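import Mathlib
import Summits.ValiantsHypothesis.ValiantsHypothesis.Theorems.DivisionGapZeroOneTransferFaceIsolationDefs

/-!
# Crux `DivisionGap.ZeroOneTransfer` (stmt-ValiantsHypothesis-5066), line `charged-uncharged`, Part E (lead c13) —
stubs `stub_offHoriz_rigid` (E6, OFF-HORIZONTAL RIGIDITY) and `stub_isolate_offHoriz` (E7, LEXICOGRAPHIC
PENALTY ISOLATION)

Rung E-II of Part E.  After the torus WLOG all exponents `u : Var n →₀ ℕ` of a certificate share their
row margins `∑_w u (v, w)` and column margins `∑_v u (v, w)`.

* `stub_offHoriz_rigid` (E6): two such exponents agreeing on every NON-horizontal variable are equal.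
  Proof: the integer difference `d = u - u'` vanishes off the horizontal pairs `((i,j),(i,j±1))` and has
  zero row and column sums.  By strong induction on the sum of the two column indices of a pair `e`:
  for `e = ((i,j),(i,j+1))` the row sum at `(i,j)` contains, besides `d e`, only non-horizontal terms and
  the term `d ((i,j),(i,j-1))` of smaller index sum; for `e = ((i,j+1),(i,j))` the column sum at `(i,j)`
  contains, besides `d e`, only non-horizontal terms and `d ((i,j-1),(i,j))`.  Hence `d = 0`.
* `stub_isolate_offHoriz` (E7): in a finite nonempty set `S` of exponents any two of which differ at a
  non-horizontal variable, some `û ∈ S` is the STRICT minimiser of a penalty weight `Finsupp.weight p`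
  with `p` supported on a set `F` of fewer than `#S` non-horizontal variables.  Proof by strong induction
  on `S`: a singleton takes `F = ∅`, `p = 0`; otherwise two distinct members differ at a non-horizontal
  `e`, the minimisers `S'` of `u ↦ u e` form a nonempty proper subset, the induction hypothesis isolates
  `û ∈ S'` by `(F', p')`, and `F = insert e F'`, `p = p' + M · [· = e]` with `M` exceeding every
  `weight p' u`, `u ∈ S`, isolates `û` in `S` (`OffHoriz.weight_add_ite`:
  `weight p u = weight p' u + u e * M`).
[folklore]
-/

noncomputable section

set_option linter.dupNamespace false

namespace Summit.ValiantsHypothesis.ValiantsHypothesis.Theorems.DivisionGapZeroOneTransfer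

open MvPolynomial
open Literature.Computability.AlgebraicComplexity
open Summit.ValiantsHypothesis.ValiantsHypothesis.Theorems.TriangularDimersDivisionEasy.Negative
open FaceIsolation
open scoped NNReal BigOperators

namespace OffHoriz

/-- Adding a spike of height `M` at `e` to a weight function adds `u e * M` to the weight of `u`.
[folklore] -/
theorem weight_add_ite {σ : Type*} [DecidableEq σ] (p' : σ → ℕ) (e : σ) (M : ℕ) (u : σ →₀ ℕ) :
    Finsupp.weight (fun x => p' x + if x = e then M else 0) u = Finsupp.weight p' u + u e * M := by
  simp only [Finsupp.weight_apply, Finsupp.sum, smul_eq_mul, mul_add, Finset.sum_add_distrib, mul_ite,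
    mul_zero, Finset.sum_ite_eq']
  congr 1
  split_ifs with h
  · rfl
  · rw [Finsupp.notMem_support_iff.1 h, zero_mul]

end OffHoriz

/-- **Stub E6 — OFF-HORIZONTAL RIGIDITY.**  Two exponents with the same row margins and the same column
margins which agree on every non-horizontal variable are equal: along each row the differences on the
horizontal pairs `((i,j),(i,j±1))` satisfy a two-term recursion with zero boundary values. [folklore] -/
theorem stub_offHoriz_rigid : ∀ (n : ℕ) (u u' : Var n →₀ ℕ),
    (∀ v : Vtx n, ∑ w, u (v, w) = ∑ w, u' (v, w)) → (∀ w : Vtx n, ∑ v, u (v, w) = ∑ v, u' (v, w)) →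
    (∀ e : Var n, ¬ IsHoriz e → u e = u' e) → u = u' := by
  intro n u u' hrow hcol hoff
  -- the integer difference `d = u - u'`
  set d : Var n → ℤ := fun e => (u e : ℤ) - u' e with hd
  have hoff' : ∀ e, ¬ IsHoriz e → d e = 0 := fun e he => by simp [hd, hoff e he]
  have hrow' : ∀ v, ∑ w, d (v, w) = 0 := fun v => by
    have h := congrArg (fun m : ℕ => (m : ℤ)) (hrow v)
    simp only [Nat.cast_sum] at h
    simp [hd, Finset.sum_sub_distrib, h]
  have hcol' : ∀ w, ∑ v, d (v, w) = 0 := fun w => by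
    have h := congrArg (fun m : ℕ => (m : ℤ)) (hcol w)
    simp only [Nat.cast_sum] at h
    simp [hd, Finset.sum_sub_distrib, h]
  -- every difference vanishes: strong induction on the sum of the two column indices
  have key : ∀ k : ℕ, ∀ e : Var n, (e.1.2 : ℕ) + e.2.2 = k → d e = 0 := by
    intro k
    refine Nat.strong_induction_on k fun k ih => ?_
    intro e hk
    by_cases he : IsHoriz e
    · obtain ⟨h1, h2 | h2⟩ := he
      · -- `e = ((i,j),(i,j+1))`: row margin at `(i,j)`
        have hs := hrow' e.1
        rw [Fintype.sum_eq_single e.2 ?_] at hs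
        · simpa using hs
        · intro w hw
          by_cases hw' : IsHoriz (e.1, w)
          · obtain ⟨h3, h4 | h4⟩ := hw'
            · have h3' : (e.1.1 : ℕ) = w.1 := h3
              have h4' : (e.1.2 : ℕ) + 1 = w.2 := h4
              exact absurd (Prod.ext (Fin.ext (by omega)) (Fin.ext (by omega))) hw
            · have h4' : (w.2 : ℕ) + 1 = e.1.2 := h4
              exact ih _ (by show (e.1.2 : ℕ) + w.2 < k; omega) (e.1, w) rfl
          · exact hoff' _ hw'
      · -- `e = ((i,j+1),(i,j))`: column margin at `(i,j)`
        have hs := hcol' e.2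
        rw [Fintype.sum_eq_single e.1 ?_] at hs
        · simpa using hs
        · intro v hv
          by_cases hv' : IsHoriz (v, e.2)
          · obtain ⟨h3, h4 | h4⟩ := hv'
            · have h4' : (v.2 : ℕ) + 1 = e.2.2 := h4
              exact ih _ (by show (v.2 : ℕ) + e.2.2 < k; omega) (v, e.2) rfl
            · have h3' : (v.1 : ℕ) = e.2.1 := h3
              have h4' : (e.2.2 : ℕ) + 1 = v.2 := h4
              exact absurd (Prod.ext (Fin.ext (by omega)) (Fin.ext (by omega))) hv
          · exact hoff' _ hv'
    · exact hoff' e he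
  ext e
  have := key _ e rfl
  simp only [hd] at this
  omega

/-- **Stub E7 — LEXICOGRAPHIC PENALTY ISOLATION.**  In a finite set of exponents any two of which differ
on a non-horizontal variable, one exponent is the strict minimiser of a weight supported on fewer than
`#S` non-horizontal variables (split off the minimisers of one separating variable and recurse).
[folklore] -/
theorem stub_isolate_offHoriz : ∀ (n : ℕ) (S : Finset (Var n →₀ ℕ)), S.Nonempty →
    (∀ u ∈ S, ∀ u' ∈ S, (∀ e : Var n, ¬ IsHoriz e → u e = u' e) → u = u') →
    ∃ (F : Finset (Var n)) (p : Var n → ℕ) (û : Var n →₀ ℕ), û ∈ S ∧ F.card + 1 ≤ S.card ∧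
      (∀ e ∈ F, ¬ IsHoriz e) ∧ (∀ e ∈ F, 0 < p e) ∧ (∀ e, e ∉ F → p e = 0) ∧
      (∀ u ∈ S, u ≠ û → Finsupp.weight p û < Finsupp.weight p u) := by
  intro n S
  induction S using Finset.strongInduction with
  | H S ih =>
  intro hS hsep
  by_cases hc : ∀ u₁ ∈ S, ∀ u₂ ∈ S, u₁ = u₂
  · -- `S` is a singleton: the zero weight on no variables
    obtain ⟨û, hû⟩ := hS
    refine ⟨∅, fun _ => 0, û, hû, ?_, ?_, ?_, ?_, ?_⟩
    · simpa using Finset.card_pos.2 ⟨û, hû⟩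
    · simp
    · simp
    · simp
    · intro u hu hne
      exact absurd (hc u hu û hû) hne
  · push Not at hc
    obtain ⟨u₁, hu₁, u₂, hu₂, hne⟩ := hc
    -- a separating non-horizontal variable `e`
    obtain ⟨e, he, hne'⟩ : ∃ e, ¬ IsHoriz e ∧ u₁ e ≠ u₂ e := by
      by_contra h
      push Not at h
      exact hne (hsep u₁ hu₁ u₂ hu₂ h)
    -- the minimisers `S'` of `u ↦ u e`
    set m₀ := S.inf' hS (fun u => u e) with hm₀
    set S' := S.filter (fun u => u e = m₀) with hS'
    have hsub : S' ⊆ S := Finset.filter_subset _ _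
    have hss : S' ⊂ S := by
      rw [hS', Finset.filter_ssubset]
      by_cases h1 : u₁ e = m₀
      · exact ⟨u₂, hu₂, fun h2 => hne' (h1.trans h2.symm)⟩
      · exact ⟨u₁, hu₁, h1⟩
    have hS'ne : S'.Nonempty := by
      obtain ⟨u, hu, hue⟩ := Finset.exists_mem_eq_inf' hS (fun u => u e)
      exact ⟨u, Finset.mem_filter.2 ⟨hu, hue.symm⟩⟩
    have hsep' : ∀ u ∈ S', ∀ u' ∈ S', (∀ x : Var n, ¬ IsHoriz x → u x = u' x) → u = u' :=
      fun u hu u' hu' h => hsep u (hsub hu) u' (hsub hu') h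
    obtain ⟨F', p', û, hû', hcard', hFnh', hpos', hzero', hmin'⟩ := ih S' hss hS'ne hsep'
    have hûS : û ∈ S := hsub hû'
    have hûe : û e = m₀ := (Finset.mem_filter.1 hû').2
    -- the new penalty: a spike at `e` dominating all the old weights
    set M := S.sup (fun u => Finsupp.weight p' u) + 1 with hM
    refine ⟨insert e F', fun x => p' x + (if x = e then M else 0), û, hûS, ?_, ?_, ?_, ?_, ?_⟩
    · have h1 := Finset.card_insert_le e F'
      have h2 := Finset.card_lt_card hss
      omega
    · intro x hx
      rcases Finset.mem_insert.1 hx with rfl | hx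
      · exact he
      · exact hFnh' x hx
    · intro x hx
      rcases Finset.mem_insert.1 hx with rfl | hx
      · simp only [if_true]
        omega
      · have := hpos' x hx
        dsimp only
        omega
    · intro x hx
      rw [Finset.mem_insert, not_or] at hx
      simp [hx.1, hzero' x hx.2]
    · intro u hu hne
      rw [OffHoriz.weight_add_ite, OffHoriz.weight_add_ite, hûe]
      by_cases hue : u e = m₀
      · have hu' : u ∈ S' := Finset.mem_filter.2 ⟨hu, hue⟩
        have := hmin' u hu' hne
        rw [hue]
        omega
      · have h1 : m₀ ≤ u e := Finset.inf'_le _ hu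
        have h2 : m₀ + 1 ≤ u e := by omega
        have h3 : Finsupp.weight p' û ≤ S.sup (fun u => Finsupp.weight p' u) :=
          Finset.le_sup (f := fun u => Finsupp.weight p' u) hûS
        have h4 : Finsupp.weight p' û + 1 ≤ M := by rw [hM]; omega
        have h5 : (m₀ + 1) * M ≤ u e * M := Nat.mul_le_mul_right M h2
        nlinarith [h4, h5]

end Summit.ValiantsHypothesis.ValiantsHypothesis.Theorems.DivisionGapZeroOneTransfer

end
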